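import Summits.CriticalPhenomena.PercolationContinuityZ3.Theorems.Transplant.SkelPhiRootClauses
import HarnessLib

/-!
# D″ node, (R) layer, file 7 (R-RECUT-PLAN §1 row 6; DPRIME-SCOPE p3 addendum M / M.9 (3)): THE ROOT RESIDUE OF THE TWO-UNIT CONCENTRIC
# SCHEME OF RECORD, RAW FORM — `Skelφ.rootOblS_concSG_raw`: `Skelφ.RootOblS G ⟨Skelφ.cellGeomSG G φ P w₀ Λ, q, δc⟩ Δ' δr` (⟹ the node-facing
# `Skel.RootOblT` by `Skelφ.rootOblT_of_rootOblS`, file 1) assembled from files 3–6: the rooted band run `RootRun2.rootSched` per direction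
# (file 3), its kit clauses `hkits_rootSched` and first hop `root_hsrc_stepI` from ONE Step-I′ certificate at the running density (file 6),
# its rim excess `real_rim_le_rootSG` from an excess radius at the running density (file 5) — every remaining hypothesis is a NUMBER
# inequality, a radius fact of the schedule `Λ`, the count, the Step-I′ certificate, or the excess radius: the binder list the L7′ params
# layer (p3-g7's `SkelSignChoice` / stmt-g9) discharges at `concChoice₀` for `RootHolds := Skel.RootOblT G (𝒞.scheme O q) Φ.Δ κ.δr` —
# the φ-level successor of p2-g5's `SkelConcRootAssembly` + `SkelConcRootClauses.rootOblA_concSG_kits`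

builds on p205010 (kernel theorem, internal audit signed; external expert review pending) — nothing in this file uses p205010.
Status sentence (coordinator 2026-08-20T04:30Z): "θ(p_c) = 0 on ℤ^d, all d ≥ 2 — kernel-verified (Lean 4/Mathlib, standard axioms); internal
adversarial audit SIGNED 2026-08-20 04:29Z; external expert review pending."
Lane `prim-bschramm-*`, seat `prim-bschramm-p2` (gen 8; (R) = p2 lineage under D″); helper file (`--supports stmt-CriticalPhenomena-4575`).

THE BINDER LIST (per direction `du` unless marked uniform; `r∥ = P.r du.1`, `r⊥ = P.r (oth du.1)`):
* the band run `RootBandOK P du s₁ R' ℓ₀ N WM Wb ca 0 q' ρ` (transverse centre `cb = 0`), level window `Rlev + 1 ≤ R'`, `j₁ ≤ Rlev`,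
  `tanOff ℓs M ≤ j₀`;
* radius facts (uniform window depth `Rt`): `Rt + 1 ≤ rB 0 0 du`, `Rt + 1 ≤ rQ 0 (0+du)`, `Rt + 1 ≤ rM 0 (0+du)`, `60 rmax ≤ Rt`, `rQ 0 0 ≤ E₀`;
* accuracy `0 < δr N ≤ 1`; the count `1/(1−q)^{Δ' Nc} ≤ δr N · #[j₀, j₁]`; the kit counts `kk (Δ+1)^{2 rs} ≤ Nc`, `(1 − q^{…})^{kk} ≤ δr N`;
* ONE Step-I′ certificate `D` over `fatSeqOff off` at the running density `q` with threshold `1 − δI`, `δI ≤ (δr N)²`, lists `Sz Sx Sy` holding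
  the kit's zone scale `Mz ≥ D.k` and extents `ℓK`, the route extents `[ℓ₀, s₁ + R']` along `du.1` (`Mz + 1 ≤ ℓ₀`) and the first-hop extent `ℓ1`;
* p1-g9's kit / slab / shell constants (uniform: `ℓs M K Rsd r₀ rs cU`, `r₀ ≤ L' ≤ Rt`), the route depth `hdepth`, the band spreads `≤ Wb`;
* the excess radius `R₁ ≤ Rt − L'` at `q` for entrances at depth `E₀ + 1` and habitats of planar diameter `mex ≥ 60 rmax`, `η ≤ δr N / 2`;
* the first hop: `ℓ1 ≤ min ca (5 r∥)`, `ca − ℓ1 + D.k ≤ 5 r∥`, `D.k ≤ 5 r⊥`, `Wb-width(ℓ1) ≤ q'`, depths `5 r∥ + ψ(D.k) + off ≤ R₀`,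
  `R₀ + 1 ≤ rQ 0 0`, `R₀ ≤ Rt`, `5 r∥ + R(ℓ1) ≤ Rp`, `Rp + 1 ≤ rQ 0 0 / rB 0 0 du / rQ 0 (0+du)`, `Rp ≤ Rt`.
* **`Skelφ.rootOblS_concSG_raw`**, **`Skelφ.rootOblT_concSG_raw`** (`:= rootOblT_of_rootOblS ∘ rootOblS_concSG_raw`).
[cite: KozmaNitzan2024, §4 p. 28 ((32) at the root), Lemma 9 (p. 16), Lemma 10 (pp. 17–22), Lemma 11 (pp. 22–23), Lemma 12 (p. 24)]
-/

noncomputable section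

open MeasureTheory ProbabilityTheory
open scoped ENNReal Classical

namespace Summit.CriticalPhenomena.PercolationContinuityZ3.Theorems

namespace Transplant

namespace Skelφ

open Literature.Probability.Percolation Literature.Probability.LatticeModels SimpleGraph GadgetSystem ProbeHistory HSiteScheme Contour KNCells
open Literature.Probability.Percolation.KozmaNitzan
open Literature.Probability.Percolation.KozmaNitzan.Cells (oth oth_ne eq_oth_of_ne sgOf sgOf_sign)
open KNCells.KSchA KNLevels ChainPlanar
open Literature.Barriers.CriticalPhenomena (graphBall mem_graphBall_self graphBall_mono)
open BoxProdZ2 (ConcRadiiG rootCtr)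
open Skel (winGraph excess RootOblT)
open SkelI (tanOff)
open RootRun2 (RootBandOK rootSched)

variable {V : Type} [DecidableEq V] [Countable V] {G : SimpleGraph V} [G.LocallyFinite] {φ : V → Site 2} {types : Finset V}

/-- **THE ROOT RESIDUE OF THE TWO-UNIT CONCENTRIC SCHEME OF RECORD, RAW FORM** (design D″, (R)): `Skelφ.RootOblS` for
`⟨Skelφ.cellGeomSG G φ P w₀ Λ, q, δc⟩` from the per-direction rooted band runs, ONE Step-I′ certificate at the running density (kit clauses and
first hop), an excess radius at the running density (rim excess), the counts and the radius facts — see the module docstring for the binder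
list. [cite: KozmaNitzan2024, §4 p. 28 ((32) at the root), Lemma 9 (p. 16), Lemma 10 (pp. 17–22), Lemma 11 (pp. 22–23), Lemma 12 (p. 24)] -/
theorem rootOblS_concSG_raw (hlip : Lip G φ) (hstep : Steps G φ) (hfr : Frames G φ types) (hκ : CylConn G φ types) {Δ : ℕ}
    (hΔ : ∀ v, G.degree v ≤ Δ) {p : unitInterval} (hC : CylSubcritical G φ types p) (P : PCells2) (w₀ : V) {Λ : ConcRadiiG}
    (hΛ : WFS2 P Λ) (hφ : φ w₀ = 0) (q : unitInterval) (δc : ℝ) {Δ' : ℕ} {δr : ℕ → ℝ} {Rt L' E₀ : ℕ}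
    -- the band runs, per direction (transverse centre `cb = 0`), and their level windows
    {s₁ R' ℓ₀ N WM Rlev Nc j₀ j₁ : MDir → ℕ} {Wb : MDir → ℕ → ℕ} {ca q' ρ : MDir → ℤ}
    (hOK : ∀ du, RootBandOK P du (s₁ du) (R' du) (ℓ₀ du) (N du) (WM du) (Wb du) (ca du) 0 (q' du) (ρ du))
    (hRl : ∀ du, Rlev du + 1 ≤ R' du) (hj : ∀ du, j₁ du ≤ Rlev du)
    -- radius facts (uniform window depth `Rt`), the depth of the wired root cube
    (hRB : ∀ du, Rt + 1 ≤ Λ.rB 0 0 du) (hRQ : ∀ du, Rt + 1 ≤ Λ.rQ 0 ((0 : Site 2) + stepVec du))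
    (hRM : ∀ du, Rt + 1 ≤ Λ.rM 0 ((0 : Site 2) + stepVec du)) (hRt : 60 * P.rmax ≤ Rt) (hQ0 : Λ.rQ 0 0 ≤ E₀)
    -- accuracy and the count
    (hδr0 : ∀ du, 0 < δr (N du)) (hδr1 : ∀ du, δr (N du) ≤ 1)
    (hcount : ∀ du, 1 / (1 - (q : ℝ)) ^ (Δ' * Nc du) ≤ δr (N du) * ((Finset.Icc (j₀ du) (j₁ du)).card : ℝ))
    -- ONE Step-I′ certificate at the running density `q`, threshold `1 − δI`, `δI ≤ (δr N)²`
    {D : StepI.Data V} {off : ℕ} (hD : D.Λ = fatSeqOff hfr hC off) {Sz Sx Sy : Finset ℕ} {δI : ℝ}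
    (hin : ∀ i ∈ StepI.index types Sz Sx Sy, 1 - δI < (bondPercolation G q).real (StepI.event G φ D i))
    (hδI : ∀ du, δI ≤ δr (N du) ^ 2)
    -- the kit: zone scale, certified extents, half-widths, radii
    {Mz : ℕ} (hMz : Mz ∈ Sz) (hkz : D.k ≤ Mz) {ℓK : Fin 2 → ℕ} (hℓK0 : ∀ I, I = 0 → ℓK I ∈ Sx) (hℓK1 : ∀ I, I = 1 → ℓK I ∈ Sy)
    {A : Fin 2 → Fin 2 → ℕ} {Rk : Fin 2 → ℕ} (hAw : ∀ I, A I = StepI.widths D.Gb D.Fb I (ℓK I)) (hRk : ∀ I, Rk I = D.R (amax (A I)))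
    -- p1-g9's kit / slab / shell constants, the level windows above `T₀`, the near threshold inside the rim
    {ℓs M K Rsd r₀ rs cU : ℕ} (hℓs : 1 ≤ ℓs) (hj₀ : ∀ du, tanOff ℓs M ≤ j₀ du)
    (hA : ∀ i k, A i k ≤ M) (hAℓ : ∀ i, A i (oth i) ≤ ℓs) (hK : ∀ i, ℓs + 1 + A i i + Rk i ≤ K)
    (hnA : ∀ i, Mz + 1 ≤ A i i) (hnM : Mz ≤ M) (hρK : ∀ i, ℓs + 1 + A i i + (fatRadius hfr hC Mz + off) ≤ K)
    (hR'₁ : cylRadMax G φ types ℓs (ℓs + 2 + 2 * tanOff ℓs M) ≤ Rsd) (hR'₂ : ∀ i, cylRadMax G φ types ℓs (ℓs + 2 + A i i + Rk i) ≤ Rsd)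
    (hr₀₁ : ℓs + 1 + tanOff ℓs M + Rsd ≤ r₀) (hr₀₂ : ℓs + 2 + tanOff ℓs M + K ≤ r₀) (hr₀L : r₀ ≤ L') (hLR : L' ≤ Rt)
    (hrs₁ : ℓs + 2 + tanOff ℓs M + Rsd ≤ rs) (hrs₂ : ℓs + 2 + tanOff ℓs M + K ≤ rs) (hcU : ∀ i, (Δ + 1) ^ Rk i ≤ cU)
    -- the routes along `du.1`: certified extents beyond the zone scale, depth, band spreads
    (hMℓ : ∀ du, Mz + 1 ≤ ℓ₀ du) (hSx : ∀ du : MDir, du.1 = 0 → ∀ ℓ, ℓ₀ du ≤ ℓ → ℓ ≤ s₁ du + R' du → ℓ ∈ Sx)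
    (hSy : ∀ du : MDir, du.1 = 1 → ∀ ℓ, ℓ₀ du ≤ ℓ → ℓ ≤ s₁ du + R' du → ℓ ∈ Sy)
    (hdepth : ∀ (du : MDir) I ℓ, ℓ₀ du ≤ ℓ → ℓ ≤ s₁ du + R' du →
      2 * ℓs + 2 + tanOff ℓs M + A I I + D.R (amax (StepI.widths D.Gb D.Fb du.1 ℓ)) ≤ r₀)
    (hWb : ∀ (du : MDir) ℓ, ℓ₀ du ≤ ℓ → ℓ ≤ s₁ du + R' du → StepI.widths D.Gb D.Fb du.1 ℓ (oth du.1) ≤ Wb du ℓ)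
    -- the kit counts
    (kk : MDir → ℕ) (hN : ∀ du, kk du * (Δ + 1) ^ (2 * rs) ≤ Nc du)
    (hk : ∀ du, (1 - (q : ℝ) ^ (1 + Δ * ((Δ + 1) ^ Rsd + (tanOff ℓs M + 2)) + ((Δ + 1) ^ Rsd + (tanOff ℓs M + 2)) * cU)) ^ kk du ≤
      δr (N du))
    -- the rim excess: an excess radius at the running density
    {mex R₁ : ℕ} {η : ℝ} (hη : ∀ du, η ≤ δr (N du) / 2) (hmex : 60 * P.rmax ≤ mex)
    (hR₁ : ∀ R'', R₁ ≤ R'' → ∀ (Rw : ℕ) (D' A' : Finset V), (∀ d ∈ D', d ∈ graphBall G w₀ Rw) →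
      (∀ d ∈ D', ∀ d' ∈ D', φ d - φ d' ∈ box 2 mex) → A' ⊆ D' → (∀ a ∈ A', a ∈ graphBall G w₀ (E₀ + 1)) →
        (bondPercolation G q).real (excess G w₀ R'' D' A') ≤ η)
    (hR : R₁ ≤ Rt - L')
    -- the first hop: extent `ℓ1` along `du.1`, its planar placement and depths
    {ℓ1 : MDir → ℕ} (hℓ1x : ∀ du : MDir, du.1 = 0 → ℓ1 du ∈ Sx) (hℓ1y : ∀ du : MDir, du.1 = 1 → ℓ1 du ∈ Sy)
    (hℓ1ca : ∀ du, (ℓ1 du : ℤ) ≤ ca du) (hℓ1Q : ∀ du : MDir, (ℓ1 du : ℤ) ≤ 5 * (P.r du.1 : ℤ))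
    (hcaQ : ∀ du : MDir, ca du - ℓ1 du + D.k ≤ 5 * (P.r du.1 : ℤ)) (hkQ : ∀ du : MDir, (D.k : ℤ) ≤ 5 * (P.r (oth du.1) : ℤ))
    (hW₁ : ∀ du : MDir, (StepI.widths D.Gb D.Fb du.1 (ℓ1 du) (oth du.1) : ℤ) ≤ q' du)
    {R₀ Rp : ℕ} (hR₀ : ∀ du : MDir, 5 * P.r du.1 + (fatRadius hfr hC D.k + off) ≤ R₀) (hR₀Q : R₀ + 1 ≤ Λ.rQ 0 0) (hR₀t : R₀ ≤ Rt)
    (hRp : ∀ du : MDir, 5 * P.r du.1 + D.R (amax (StepI.widths D.Gb D.Fb du.1 (ℓ1 du))) ≤ Rp) (hRpQ : Rp + 1 ≤ Λ.rQ 0 0)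
    (hRpB : ∀ du, Rp + 1 ≤ Λ.rB 0 0 du) (hRpQ' : ∀ du, Rp + 1 ≤ Λ.rQ 0 ((0 : Site 2) + stepVec du)) (hRpt : Rp ≤ Rt) :
    RootOblS G (⟨cellGeomSG G φ P w₀ Λ, q, δc⟩ : KSchA V ℕ) Δ' δr := by
  set Sc : MDir → Schedule := fun du => rootSched P du (hOK du) with hScdef
  set U : MDir → Finset V := fun du => rootUS G φ P w₀ Λ q δc Rt du with hUdef
  set Pc : MDir → WinChainData V := fun du => rootWCD G φ w₀ Rt L' (Sc du) (Rlev du) (Nc du) (j₀ du) (j₁ du) (U du) with hPcdef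
  -- the certificate at the per-direction thresholds `1 − (δr N)²` and `1 − δr N`
  have hsq : ∀ du, δr (N du) ^ 2 ≤ δr (N du) := fun du => by nlinarith [hδr0 du, hδr1 du]
  have hin' : ∀ du, ∀ i ∈ StepI.index types Sz Sx Sy, 1 - δr (N du) ^ 2 < (bondPercolation G q).real (StepI.event G φ D i) :=
    fun du i hi => lt_of_le_of_lt (by linarith [hδI du]) (hin i hi)
  -- the first hop, per direction
  have hhop : ∀ du, ∃ B₀ : Finset V, B₀ ⊆ Win G φ w₀ ((Sc du).core 0) Rt ∧
      1 - δI < (prodBernoulli ((⟨cellGeomSG G φ P w₀ Λ, q, δc⟩ : KSchA V ℕ).W0sub G (U du))).real (⋃ t ∈ B₀, openConn w₀ t) :=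
    fun du => root_hsrc_stepI hstep hfr hC hφ (hOK du) hD hin (hℓ1x du) (hℓ1y du) (hℓ1ca du) (hℓ1Q du) (hcaQ du) (hkQ du) (hW₁ du)
      (hR₀ du) hR₀Q hR₀t (hRp du) hRpQ (hRpB du) (hRpQ' du) hRpt
  choose B₀ hB₀ hsrc using hhop
  refine rootOblS_of_rootRunSG hlip hstep P w₀ hΛ hφ q δc hOK hRl hj Sc (fun _ => rfl) Pc (fun _ => rfl) hRB hRQ hRM hRt
    (fun du => hcount du) (fun du k hkN j hjj => ?_) (η := η) (fun du => hη du) (fun du k hkN => ?_) (B₀ := B₀)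
    (Bpl := fun du => (Sc du).core 0) hB₀ (fun du => subset_rfl) (fun du => ?_)
  · -- the kit clauses (file 6)
    exact hkits_rootSched hlip hstep hfr hκ hΔ hC (hOK du) (hRB du) (hRQ du) (hRl du) (hj du) hD (hδr0 du) (hin' du) hMz hkz hℓK0 hℓK1
      hAw hRk hℓs (hj₀ du) hA hAℓ hK hnA hnM hρK hR'₁ hR'₂ hr₀₁ hr₀₂ hr₀L hLR hrs₁ hrs₂ hcU (hMℓ du) (hSx du) (hSy du) (hdepth du)
      (hWb du) (kk du) (hN du) (hk du) (Sc du) rfl (Pc du) rfl hkN hjj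
  · -- the rim excess (file 5)
    exact real_rim_le_rootSG hlip hstep hΛ hφ (hOK du) (hRB du) (hRQ du) hQ0 hmex hR₁ hR hkN
  · -- the first hop at accuracy `δr N` (`δI ≤ (δr N)² ≤ δr N`)
    change 1 - δr (N du) < _
    exact lt_of_le_of_lt (by linarith [hδI du, hsq du]) (hsrc du)

/-- **THE NODE-FACING ROOT RESIDUE `Skel.RootOblT` OF THE TWO-UNIT SCHEME OF RECORD, RAW FORM** (`rootOblT_of_rootOblS ∘ rootOblS_concSG_raw`):
the `RootHolds` head of p3-g7's `SkelSignChoice` modulo the binder list of the module docstring.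
[cite: KozmaNitzan2024, §4 p. 28 ((32) at the root), Lemma 11 (pp. 22–23), Lemma 12 (p. 24)] -/
theorem rootOblT_concSG_raw (hlip : Lip G φ) (hstep : Steps G φ) (hfr : Frames G φ types) (hκ : CylConn G φ types) {Δ : ℕ}
    (hΔ : ∀ v, G.degree v ≤ Δ) {p : unitInterval} (hC : CylSubcritical G φ types p) (P : PCells2) (w₀ : V) {Λ : ConcRadiiG}
    (hΛ : WFS2 P Λ) (hφ : φ w₀ = 0) (q : unitInterval) (δc : ℝ) {Δ' : ℕ} {δr : ℕ → ℝ} {Rt L' E₀ : ℕ}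
    {s₁ R' ℓ₀ N WM Rlev Nc j₀ j₁ : MDir → ℕ} {Wb : MDir → ℕ → ℕ} {ca q' ρ : MDir → ℤ}
    (hOK : ∀ du, RootBandOK P du (s₁ du) (R' du) (ℓ₀ du) (N du) (WM du) (Wb du) (ca du) 0 (q' du) (ρ du))
    (hRl : ∀ du, Rlev du + 1 ≤ R' du) (hj : ∀ du, j₁ du ≤ Rlev du)
    (hRB : ∀ du, Rt + 1 ≤ Λ.rB 0 0 du) (hRQ : ∀ du, Rt + 1 ≤ Λ.rQ 0 ((0 : Site 2) + stepVec du))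
    (hRM : ∀ du, Rt + 1 ≤ Λ.rM 0 ((0 : Site 2) + stepVec du)) (hRt : 60 * P.rmax ≤ Rt) (hQ0 : Λ.rQ 0 0 ≤ E₀)
    (hδr0 : ∀ du, 0 < δr (N du)) (hδr1 : ∀ du, δr (N du) ≤ 1)
    (hcount : ∀ du, 1 / (1 - (q : ℝ)) ^ (Δ' * Nc du) ≤ δr (N du) * ((Finset.Icc (j₀ du) (j₁ du)).card : ℝ))
    {D : StepI.Data V} {off : ℕ} (hD : D.Λ = fatSeqOff hfr hC off) {Sz Sx Sy : Finset ℕ} {δI : ℝ}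
    (hin : ∀ i ∈ StepI.index types Sz Sx Sy, 1 - δI < (bondPercolation G q).real (StepI.event G φ D i))
    (hδI : ∀ du, δI ≤ δr (N du) ^ 2)
    {Mz : ℕ} (hMz : Mz ∈ Sz) (hkz : D.k ≤ Mz) {ℓK : Fin 2 → ℕ} (hℓK0 : ∀ I, I = 0 → ℓK I ∈ Sx) (hℓK1 : ∀ I, I = 1 → ℓK I ∈ Sy)
    {A : Fin 2 → Fin 2 → ℕ} {Rk : Fin 2 → ℕ} (hAw : ∀ I, A I = StepI.widths D.Gb D.Fb I (ℓK I)) (hRk : ∀ I, Rk I = D.R (amax (A I)))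
    {ℓs M K Rsd r₀ rs cU : ℕ} (hℓs : 1 ≤ ℓs) (hj₀ : ∀ du, tanOff ℓs M ≤ j₀ du)
    (hA : ∀ i k, A i k ≤ M) (hAℓ : ∀ i, A i (oth i) ≤ ℓs) (hK : ∀ i, ℓs + 1 + A i i + Rk i ≤ K)
    (hnA : ∀ i, Mz + 1 ≤ A i i) (hnM : Mz ≤ M) (hρK : ∀ i, ℓs + 1 + A i i + (fatRadius hfr hC Mz + off) ≤ K)
    (hR'₁ : cylRadMax G φ types ℓs (ℓs + 2 + 2 * tanOff ℓs M) ≤ Rsd) (hR'₂ : ∀ i, cylRadMax G φ types ℓs (ℓs + 2 + A i i + Rk i) ≤ Rsd)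
    (hr₀₁ : ℓs + 1 + tanOff ℓs M + Rsd ≤ r₀) (hr₀₂ : ℓs + 2 + tanOff ℓs M + K ≤ r₀) (hr₀L : r₀ ≤ L') (hLR : L' ≤ Rt)
    (hrs₁ : ℓs + 2 + tanOff ℓs M + Rsd ≤ rs) (hrs₂ : ℓs + 2 + tanOff ℓs M + K ≤ rs) (hcU : ∀ i, (Δ + 1) ^ Rk i ≤ cU)
    (hMℓ : ∀ du, Mz + 1 ≤ ℓ₀ du) (hSx : ∀ du : MDir, du.1 = 0 → ∀ ℓ, ℓ₀ du ≤ ℓ → ℓ ≤ s₁ du + R' du → ℓ ∈ Sx)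
    (hSy : ∀ du : MDir, du.1 = 1 → ∀ ℓ, ℓ₀ du ≤ ℓ → ℓ ≤ s₁ du + R' du → ℓ ∈ Sy)
    (hdepth : ∀ (du : MDir) I ℓ, ℓ₀ du ≤ ℓ → ℓ ≤ s₁ du + R' du →
      2 * ℓs + 2 + tanOff ℓs M + A I I + D.R (amax (StepI.widths D.Gb D.Fb du.1 ℓ)) ≤ r₀)
    (hWb : ∀ (du : MDir) ℓ, ℓ₀ du ≤ ℓ → ℓ ≤ s₁ du + R' du → StepI.widths D.Gb D.Fb du.1 ℓ (oth du.1) ≤ Wb du ℓ)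
    (kk : MDir → ℕ) (hN : ∀ du, kk du * (Δ + 1) ^ (2 * rs) ≤ Nc du)
    (hk : ∀ du, (1 - (q : ℝ) ^ (1 + Δ * ((Δ + 1) ^ Rsd + (tanOff ℓs M + 2)) + ((Δ + 1) ^ Rsd + (tanOff ℓs M + 2)) * cU)) ^ kk du ≤
      δr (N du))
    {mex R₁ : ℕ} {η : ℝ} (hη : ∀ du, η ≤ δr (N du) / 2) (hmex : 60 * P.rmax ≤ mex)
    (hR₁ : ∀ R'', R₁ ≤ R'' → ∀ (Rw : ℕ) (D' A' : Finset V), (∀ d ∈ D', d ∈ graphBall G w₀ Rw) →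
      (∀ d ∈ D', ∀ d' ∈ D', φ d - φ d' ∈ box 2 mex) → A' ⊆ D' → (∀ a ∈ A', a ∈ graphBall G w₀ (E₀ + 1)) →
        (bondPercolation G q).real (excess G w₀ R'' D' A') ≤ η)
    (hR : R₁ ≤ Rt - L')
    {ℓ1 : MDir → ℕ} (hℓ1x : ∀ du : MDir, du.1 = 0 → ℓ1 du ∈ Sx) (hℓ1y : ∀ du : MDir, du.1 = 1 → ℓ1 du ∈ Sy)
    (hℓ1ca : ∀ du, (ℓ1 du : ℤ) ≤ ca du) (hℓ1Q : ∀ du : MDir, (ℓ1 du : ℤ) ≤ 5 * (P.r du.1 : ℤ))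
    (hcaQ : ∀ du : MDir, ca du - ℓ1 du + D.k ≤ 5 * (P.r du.1 : ℤ)) (hkQ : ∀ du : MDir, (D.k : ℤ) ≤ 5 * (P.r (oth du.1) : ℤ))
    (hW₁ : ∀ du : MDir, (StepI.widths D.Gb D.Fb du.1 (ℓ1 du) (oth du.1) : ℤ) ≤ q' du)
    {R₀ Rp : ℕ} (hR₀ : ∀ du : MDir, 5 * P.r du.1 + (fatRadius hfr hC D.k + off) ≤ R₀) (hR₀Q : R₀ + 1 ≤ Λ.rQ 0 0) (hR₀t : R₀ ≤ Rt)
    (hRp : ∀ du : MDir, 5 * P.r du.1 + D.R (amax (StepI.widths D.Gb D.Fb du.1 (ℓ1 du))) ≤ Rp) (hRpQ : Rp + 1 ≤ Λ.rQ 0 0)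
    (hRpB : ∀ du, Rp + 1 ≤ Λ.rB 0 0 du) (hRpQ' : ∀ du, Rp + 1 ≤ Λ.rQ 0 ((0 : Site 2) + stepVec du)) (hRpt : Rp ≤ Rt) :
    RootOblT G (⟨cellGeomSG G φ P w₀ Λ, q, δc⟩ : KSchA V ℕ) Δ' δr :=
  rootOblT_of_rootOblS (rootOblS_concSG_raw hlip hstep hfr hκ hΔ hC P w₀ hΛ hφ q δc hOK hRl hj hRB hRQ hRM hRt hQ0 hδr0 hδr1 hcount hD hin
    hδI hMz hkz hℓK0 hℓK1 hAw hRk hℓs hj₀ hA hAℓ hK hnA hnM hρK hR'₁ hR'₂ hr₀₁ hr₀₂ hr₀L hLR hrs₁ hrs₂ hcU hMℓ hSx hSy hdepth hWb kk hN hk hη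
    hmex hR₁ hR hℓ1x hℓ1y hℓ1ca hℓ1Q hcaQ hkQ hW₁ hR₀ hR₀Q hR₀t hRp hRpQ hRpB hRpQ' hRpt)

end Skelφ

end Transplant

end Summit.CriticalPhenomena.PercolationContinuityZ3.Theorems

end
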